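import Mathlib
import HarnessLib
import Summits.NavierStokesRegularity.NavierStokesRegularity.Theorems.PoloidalWindowDoorPoloidalWindowRigidityLargeScaleEnergyBootstrapLevels
import Summits.NavierStokesRegularity.NavierStokesRegularity.Theorems.PoloidalWindowDoorPoloidalWindowRigidityLargeScaleEnergyBootstrapFloorStep
import Summits.NavierStokesRegularity.NavierStokesRegularity.Theorems.PoloidalWindowDoorPoloidalWindowRigidityLargeScaleEnergyPressureTwo

/-!
# Route `PoloidalWindowDoor`, crux `PoloidalWindowRigidity` (K2, stmt-NavierStokesRegularity-19708) — whole-class theorem: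
# THE LARGE-SCALE ENERGY BOOTSTRAP DOWN TO THE FLOOR, UNCONDITIONAL —
# `∫_{B̄(0,R)} ‖v(t)‖² ≤ K_α R^α (−t)^{−(α−1)/2}` for EVERY `α > 1`

Cell ns-regularity-ideate, seat ns-poloidal-K2-p3 gen 3 (stub-worker under the K2 lead ns-poloidal-K2-p1 g3, LEAD LINE #1
(2); file landed `--supports stmt-NavierStokesRegularity-19708` as a helper).  Sequel of `…LargeScaleEnergyBootstrapLevels`
(levels `α > 3/2` from the `L^{3/2}` class pressure bound): with the `L²` class pressure bound
`…LargeScaleEnergyPressureTwo.exists_integral_rpow_two_sub_le_class` (Calderón–Zygmund at `p = 2`, the tree's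
`exists_eLpNorm_hessConv_le_of_memLp`) and the Cauchy–Schwarz window step
`…LargeScaleEnergyBootstrapFloorStep.energy_ball_le_of_level_two` the map is `α ↦ (1+α)/2`, fixed point `1`:
* `levelStepTwo_at_neg_one`, `levelStepTwo` — LEVEL `α` ⇒ LEVEL `(1+α)/2` (`1 < α < 3`), unconditional;
* `exists_level_of_gt_one` — **for every profile of the Type-I mild class and every `1 < α ≤ 3` there is `K ≥ 0`
  with `∫_{B̄(0,R)}‖v(t)‖² ≤ K R^α (−t)^{−(α−1)/2}` for all `t < 0`, `R > 0`.**
Reading: TIME-Type-I ancient mild solutions are `ε`-close, at every scale above the parabolic one, to the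
scale-invariant local-energy class (`R⁻¹∫_{B̄_R}|v|² ≲ (R/√(−t))^{ε}`); `α = 1` itself is not reached by this
argument (the initial end `∫φ|v(−R²)|² ∼ R` and the Laplacian flux `∼ R/(1−β)` are exactly of floor size).

WHAT THIS IS NOT: not a claim about Navier–Stokes regularity and not the open residue S2⁗ — an unconditional
large-scale estimate for the whole Type-I mild class (bears_on LADDER-NS N0; also TypeILiouville / NoTypeII routes).
-/

noncomputable section

-- the summit and its single sub-problem share the name (CONVENTIONS §1), as in every Theorems file
set_option linter.dupNamespace false

namespace Summit.NavierStokesRegularity.NavierStokesRegularity.Theorems.PoloidalWindowDoorPoloidalWindowRigidityLargeScaleEnergyBootstrapFloor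

open MeasureTheory Set Function Filter Topology Metric
open scoped RealInnerProductSpace
open Literature.Analysis Literature.Analysis.FluidPDE Literature.Analysis.UnboundedOperators
open Summit.NavierStokesRegularity.NavierStokesRegularity.Theorems.PoloidalWindowDoorPoloidalWindowRigidityLargeScaleEnergyBootstrapFloorStep
open Summit.NavierStokesRegularity.NavierStokesRegularity.Theorems.PoloidalWindowDoorPoloidalWindowRigidityLargeScaleEnergyBootstrapScaling
open Summit.NavierStokesRegularity.NavierStokesRegularity.Theorems.PoloidalWindowDoorPoloidalWindowRigidityLargeScaleEnergyPressureTwo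
open Summit.NavierStokesRegularity.NavierStokesRegularity.Theorems.PoloidalWindowDoorPoloidalWindowRigidityLargeScaleEnergyBootstrapLevels
open Summit.NavierStokesRegularity.NavierStokesRegularity.Theorems.PoloidalWindowDoorPoloidalWindowRigidityWindow
  (isTypeIAncientMild_of_class)

variable {C : ℝ} {v : ℝ → EuclideanSpace ℝ (Fin 3) → EuclideanSpace ℝ (Fin 3)}

/-! ### LEVEL `α` ⇒ LEVEL `(1+α)/2` -/

/-- **The floor step at time `−1`.**  For `1 < α < 3`, `K₀ ≥ 0` there is `K' ≥ 0` such that every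
profile of the class (rate `C`) at LEVEL `α` (constant `K₀`) satisfies `∫_{B̄(0,R)}‖v(−1)‖² ≤ K' R^{(1+α)/2}` for all
`R ≥ 1` (`energy_ball_le_of_level_two` on `[−R², −1]` with the `L²` class pressure bound at radius `2R ≥ 1`). -/
theorem levelStepTwo_at_neg_one (C K₀ α : ℝ) (hK0 : 0 ≤ K₀) (hα1 : 1 < α) (hα3 : α < 3) :
    ∃ K' : ℝ, 0 ≤ K' ∧
    ∀ v : ℝ → EuclideanSpace ℝ (Fin 3) → EuclideanSpace ℝ (Fin 3), HasTypeITimeDecay C v →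
      ContinuousOn (uncurry v) (Iio (0 : ℝ) ×ˢ univ) →
      (∀ s t : ℝ, s < t → t < 0 → ∀ x, v t x = heatExtension (v s) (t - s) x - oseenDuhamel 1 s v v t x) →
      (∀ t < 0, VectorCalculus.IsDivFree (v t)) →
      (∀ t < 0, ∀ R : ℝ, 0 < R → ∫ x in closedBall (0 : EuclideanSpace ℝ (Fin 3)) R, ‖v t x‖ ^ 2 ≤
        K₀ * R ^ α * (-t) ^ (-((α - 1) / 2))) →
      ∀ R : ℝ, 1 ≤ R → ∫ x in closedBall (0 : EuclideanSpace ℝ (Fin 3)) R, ‖v (-1) x‖ ^ 2 ≤ K' * R ^ ((1 + α) / 2) := by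
  obtain ⟨C₁, hC₁0, hC₁⟩ := exists_norm_fderiv_cutoff_le (E := EuclideanSpace ℝ (Fin 3))
  obtain ⟨C₂, hC₂0, hC₂⟩ := exists_abs_laplacian_cutoff_le (E := EuclideanSpace ℝ (Fin 3))
  obtain ⟨A₀, hA₀0, hP32⟩ := exists_integral_rpow_two_sub_le_class
  set V₁ : ℝ := volume.real (closedBall (0 : EuclideanSpace ℝ (Fin 3)) 1) with hV₁
  have hV₁0 : 0 ≤ V₁ := measureReal_nonneg
  set A : ℝ := A₀ * C ^ 2 with hA
  have hA0 : 0 ≤ A := by positivity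
  have h3α : 0 < 3 - α := by linarith
  have hα0 : 0 < α := by linarith
  have hα1' : 0 < α - 1 := by linarith
  refine ⟨K₀ * 2 ^ α * (1 + C₂ * (2 / (3 - α))) +
      C₁ * 2 ^ ((3 + α) / 2) * V₁ ^ (1 / 2 : ℝ) * K₀ ^ (1 / 2 : ℝ) * (C ^ 2 + 2 * A) * (4 / (α - 1)),
    by positivity, ?_⟩
  intro v hrate hcont hmild hdiv hL R hR
  have hR0 : 0 < R := by linarith
  have hAM : IsTypeIAncientMild C v := isTypeIAncientMild_of_class hrate hcont hmild hdiv
  have hwin : -R ^ 2 - 1 < 0 := by nlinarith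
  obtain ⟨p, hp⟩ := hAM.exists_isClassicalNSSolutionOn_Ioo hwin
  have hI : Icc (-R ^ 2) (-1) ⊆ Ioo (-R ^ 2 - 1) 0 := fun s hs => ⟨by linarith [hs.1], by linarith [hs.2]⟩
  have hC : ∀ s ∈ Icc (-R ^ 2) (-1), ∀ x, ‖v s x‖ ≤ C / Real.sqrt (-s) := fun s hs x =>
    hrate s (by linarith [hs.2]) x
  have hE : ∀ s ∈ Icc (-R ^ 2) (-1), ∫ x in closedBall (0 : EuclideanSpace ℝ (Fin 3)) (2 * R), ‖v s x‖ ^ 2 ≤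
      K₀ * (2 * R) ^ α * (-s) ^ (-((α - 1) / 2)) := fun s hs => hL s (by linarith [hs.2]) (2 * R) (by linarith)
  have hosc : ∀ s ∈ Icc (-R ^ 2) (-1), ∃ c : ℝ,
      ∫ x in closedBall (0 : EuclideanSpace ℝ (Fin 3)) (2 * R), |p s x - c| ^ (2 : ℝ) ≤
        (A / (-s)) ^ (2 : ℝ) * volume.real (closedBall (0 : EuclideanSpace ℝ (Fin 3)) (2 * R)) := by
    intro s hs
    obtain ⟨κ, hκ⟩ := hP32 hrate hmild hwin hp s (hI hs) 0 (2 * R) (by linarith)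
    exact ⟨κ, by rw [hA]; exact hκ⟩
  have hRt : Real.sqrt (-(-1 : ℝ)) ≤ R := by rw [neg_neg, Real.sqrt_one]; exact hR
  have h := energy_ball_le_of_level_two hp isOpen_Ioo (by norm_num) hRt hI hA0 hK0 hα1 hα3 hC hE hosc
    (hC₁ R hR0) (hC₂ R hR0)
  rw [neg_neg, Real.one_rpow, mul_one] at h
  rw [setIntegral_closedBall_eq_ball]
  exact h

/-- **LEVEL `α` ⇒ LEVEL `(1+α)/2` (unconditional).**  If a profile of the class is at LEVEL `α` (`1 < α < 3`)
then it is at LEVEL `(1+α)/2`: `∃ K' ≥ 0, ∀ t < 0, ∀ R > 0, ∫_{B̄(0,R)}‖v(t)‖² ≤ K' R^{(1+α)/2} (−t)^{−(α−1)/4}`. -/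
theorem levelStepTwo (hrate : HasTypeITimeDecay C v)
    (hcont : ContinuousOn (uncurry v) (Iio (0 : ℝ) ×ˢ univ))
    (hmild : ∀ s t : ℝ, s < t → t < 0 → ∀ x,
      v t x = heatExtension (v s) (t - s) x - oseenDuhamel 1 s v v t x)
    (hdiv : ∀ t < 0, VectorCalculus.IsDivFree (v t)) {α K₀ : ℝ} (hα1 : 1 < α) (hα3 : α < 3) (hK0 : 0 ≤ K₀)
    (hL : ∀ t < 0, ∀ R : ℝ, 0 < R → ∫ x in closedBall (0 : EuclideanSpace ℝ (Fin 3)) R, ‖v t x‖ ^ 2 ≤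
      K₀ * R ^ α * (-t) ^ (-((α - 1) / 2))) :
    ∃ K' : ℝ, 0 ≤ K' ∧ ∀ t < 0, ∀ R : ℝ, 0 < R →
      ∫ x in closedBall (0 : EuclideanSpace ℝ (Fin 3)) R, ‖v t x‖ ^ 2 ≤
        K' * R ^ ((1 + α) / 2) * (-t) ^ (-((((1 + α) / 2) - 1) / 2)) := by
  obtain ⟨K', hK'0, H⟩ := levelStepTwo_at_neg_one C K₀ α hK0 hα1 hα3
  set V₁ : ℝ := volume.real (closedBall (0 : EuclideanSpace ℝ (Fin 3)) 1) with hV₁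
  have hV₁0 : 0 ≤ V₁ := measureReal_nonneg
  refine ⟨K' + C ^ 2 * V₁, by positivity, fun t ht R hR => ?_⟩
  have hX : 0 ≤ R ^ ((1 + α) / 2) * (-t) ^ (-((((1 + α) / 2) - 1) / 2)) :=
    mul_nonneg (Real.rpow_nonneg hR.le _) (Real.rpow_nonneg (by linarith) _)
  rcases le_or_gt (Real.sqrt (-t)) R with hle | hlt
  · -- large radii: transport; the property `class ∧ level α` is zoom-invariant
    have hPz : ∀ w : ℝ → EuclideanSpace ℝ (Fin 3) → EuclideanSpace ℝ (Fin 3),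
        (HasTypeITimeDecay C w ∧ ContinuousOn (uncurry w) (Iio (0 : ℝ) ×ˢ univ) ∧
          (∀ s t : ℝ, s < t → t < 0 → ∀ x, w t x = heatExtension (w s) (t - s) x - oseenDuhamel 1 s w w t x) ∧
          (∀ t < 0, VectorCalculus.IsDivFree (w t)) ∧
          (∀ t < 0, ∀ R : ℝ, 0 < R → ∫ x in closedBall (0 : EuclideanSpace ℝ (Fin 3)) R, ‖w t x‖ ^ 2 ≤
            K₀ * R ^ α * (-t) ^ (-((α - 1) / 2)))) →
        ∀ c : ℝ, 0 < c → (HasTypeITimeDecay C (fun s y => c • w (c ^ 2 * s) (c • y)) ∧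
          ContinuousOn (uncurry fun s y => c • w (c ^ 2 * s) (c • y)) (Iio (0 : ℝ) ×ˢ univ) ∧
          (∀ s t : ℝ, s < t → t < 0 → ∀ x, (fun s y => c • w (c ^ 2 * s) (c • y)) t x =
            heatExtension ((fun s y => c • w (c ^ 2 * s) (c • y)) s) (t - s) x -
              oseenDuhamel 1 s (fun s y => c • w (c ^ 2 * s) (c • y)) (fun s y => c • w (c ^ 2 * s) (c • y)) t x) ∧
          (∀ t < 0, VectorCalculus.IsDivFree ((fun s y => c • w (c ^ 2 * s) (c • y)) t)) ∧
          (∀ t < 0, ∀ R : ℝ, 0 < R →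
            ∫ x in closedBall (0 : EuclideanSpace ℝ (Fin 3)) R, ‖(fun s y => c • w (c ^ 2 * s) (c • y)) t x‖ ^ 2 ≤
              K₀ * R ^ α * (-t) ^ (-((α - 1) / 2)))) := by
      intro w hw c hc
      obtain ⟨h1, h2, h3, h4⟩ := class_zoom₀ hw.1 hw.2.1 hw.2.2.1 hw.2.2.2.1 hc
      refine ⟨h1, h2, h3, h4, fun t ht R hR => ?_⟩
      have hct : c ^ 2 * t < 0 := mul_neg_of_pos_of_neg (pow_pos hc 2) ht
      have hb := hw.2.2.2.2 (c ^ 2 * t) hct (c * R) (mul_pos hc hR)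
      show ∫ x in closedBall (0 : EuclideanSpace ℝ (Fin 3)) R, ‖c • w (c ^ 2 * t) (c • x)‖ ^ 2 ≤ _
      rw [setIntegral_closedBall_norm_sq_zoom w hc t hR.le]
      -- `c⁻¹ K₀ (cR)^α (c²(−t))^{−β} = K₀ R^α (−t)^{−β}` since `α − 2β − 1 = 0`
      have ht0 : 0 < -t := neg_pos.2 ht
      have e : c⁻¹ * (K₀ * (c * R) ^ α * (-(c ^ 2 * t)) ^ (-((α - 1) / 2))) =
          K₀ * R ^ α * (-t) ^ (-((α - 1) / 2)) := by
        rw [Real.mul_rpow hc.le hR.le, show (-(c ^ 2 * t)) = c ^ 2 * (-t) by ring,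
          Real.mul_rpow (pow_nonneg hc.le 2) ht0.le, show (c ^ 2 : ℝ) = c ^ (2 : ℝ) by norm_cast,
          ← Real.rpow_mul hc.le]
        have hcc : c⁻¹ * c ^ α * c ^ ((2 : ℝ) * -((α - 1) / 2)) = 1 := by
          rw [← Real.rpow_neg_one, ← Real.rpow_add hc, ← Real.rpow_add hc,
            show (-1 : ℝ) + α + 2 * -((α - 1) / 2) = 0 by ring, Real.rpow_zero]
        calc c⁻¹ * (K₀ * (c ^ α * R ^ α) * (c ^ ((2 : ℝ) * -((α - 1) / 2)) * (-t) ^ (-((α - 1) / 2))))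
            = (c⁻¹ * c ^ α * c ^ ((2 : ℝ) * -((α - 1) / 2))) * (K₀ * R ^ α * (-t) ^ (-((α - 1) / 2))) := by ring
          _ = K₀ * R ^ α * (-t) ^ (-((α - 1) / 2)) := by rw [hcc, one_mul]
      calc c⁻¹ * ∫ y in closedBall (0 : EuclideanSpace ℝ (Fin 3)) (c * R), ‖w (c ^ 2 * t) y‖ ^ 2
          ≤ c⁻¹ * (K₀ * (c * R) ^ α * (-(c ^ 2 * t)) ^ (-((α - 1) / 2))) :=
            mul_le_mul_of_nonneg_left hb (inv_nonneg.2 hc.le)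
        _ = K₀ * R ^ α * (-t) ^ (-((α - 1) / 2)) := e
    have h := level_of_level_at_neg_one (K := K') (α := (1 + α) / 2) hPz
      (fun w hw R hR => H w hw.1 hw.2.1 hw.2.2.1 hw.2.2.2.1 hw.2.2.2.2 R hR) ⟨hrate, hcont, hmild, hdiv, hL⟩ ht hle
    calc _ ≤ K' * R ^ ((1 + α) / 2) * (-t) ^ (-((((1 + α) / 2) - 1) / 2)) := h
      _ ≤ (K' + C ^ 2 * V₁) * R ^ ((1 + α) / 2) * (-t) ^ (-((((1 + α) / 2) - 1) / 2)) := by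
          rw [mul_assoc, mul_assoc]; exact mul_le_mul_of_nonneg_right (by nlinarith) hX
  · have h := setIntegral_closedBall_norm_sq_le_of_small hrate (α := (1 + α) / 2) (by linarith) ht hR hlt.le
    calc _ ≤ C ^ 2 * V₁ * R ^ ((1 + α) / 2) * (-t) ^ (-((((1 + α) / 2) - 1) / 2)) := h
      _ ≤ (K' + C ^ 2 * V₁) * R ^ ((1 + α) / 2) * (-t) ^ (-((((1 + α) / 2) - 1) / 2)) := by
          rw [mul_assoc (K' + _), mul_assoc (C ^ 2 * V₁)]; exact mul_le_mul_of_nonneg_right (by linarith) hX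

/-! ### Every level `α > 1` -/

/-- **THE LARGE-SCALE ENERGY BOOTSTRAP DOWN TO THE FLOOR (unconditional): LEVEL `α` FOR EVERY `1 < α ≤ 3`.**  For
every profile of the route's Type-I class and every `α ∈ (1, 3]` there is `K ≥ 0` with
`∫_{B̄(0,R)} ‖v(t,x)‖² dx ≤ K · R^α · (−t)^{−(α−1)/2}` for all `t < 0`, `R > 0` — i.e. `ε`-close to the
scale-invariant local energy class `sup_{t,R ≥ √(−t)} R⁻¹∫_{B̄_R}‖v(t)‖² < ∞` (KNSS / Seregin scaled energy).
(Iterate LEVEL `α ↦ (1+α)/2` from LEVEL `2` along `α_n = 1 + 2^{−n}`, then monotonicity in `α` for `R ≥ √(−t)` and the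
Type-I rate for `R ≤ √(−t)`.) -/
theorem exists_level_of_gt_one (hrate : HasTypeITimeDecay C v)
    (hcont : ContinuousOn (uncurry v) (Iio (0 : ℝ) ×ˢ univ))
    (hmild : ∀ s t : ℝ, s < t → t < 0 → ∀ x,
      v t x = heatExtension (v s) (t - s) x - oseenDuhamel 1 s v v t x)
    (hdiv : ∀ t < 0, VectorCalculus.IsDivFree (v t)) {α : ℝ} (hα : 1 < α) (hα3 : α ≤ 3) :
    ∃ K : ℝ, 0 ≤ K ∧ ∀ t < 0, ∀ R : ℝ, 0 < R →
      ∫ x in closedBall (0 : EuclideanSpace ℝ (Fin 3)) R, ‖v t x‖ ^ 2 ≤ K * R ^ α * (-t) ^ (-((α - 1) / 2)) := by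
  have hC0 := typeI_const_nonneg hrate
  -- the levels `α_n = 1 + 2^{-n}`
  have hseq : ∀ n : ℕ, ∃ K : ℝ, 0 ≤ K ∧ ∀ t < 0, ∀ R : ℝ, 0 < R →
      ∫ x in closedBall (0 : EuclideanSpace ℝ (Fin 3)) R, ‖v t x‖ ^ 2 ≤
        K * R ^ ((1 : ℝ) + (1 / 2 : ℝ) ^ n) * (-t) ^ (-(((1 : ℝ) + (1 / 2 : ℝ) ^ n - 1) / 2)) := by
    intro n
    induction n with
    | zero =>
      have e : (1 : ℝ) + (1 / 2 : ℝ) ^ 0 = 2 := by norm_num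
      rw [e]
      exact exists_levelTwo hrate hcont hmild hdiv
    | succ n ih =>
      obtain ⟨K, hK0, hK⟩ := ih
      have hlt : (1 : ℝ) < (1 : ℝ) + (1 / 2 : ℝ) ^ n := by
        have : 0 < (1 / 2 : ℝ) ^ n := by positivity
        linarith
      have hlt3 : (1 : ℝ) + (1 / 2 : ℝ) ^ n < 3 := by
        have : (1 / 2 : ℝ) ^ n ≤ 1 := pow_le_one₀ (by norm_num) (by norm_num)
        linarith
      have e : (1 : ℝ) + (1 / 2 : ℝ) ^ (n + 1) = (1 + ((1 : ℝ) + (1 / 2 : ℝ) ^ n)) / 2 := by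
        rw [pow_succ]; ring
      rw [e]
      exact levelStepTwo hrate hcont hmild hdiv hlt hlt3 hK0 hK
  -- choose `n` with `α_n ≤ α`
  obtain ⟨n, hn⟩ := exists_pow_lt_of_lt_one (by linarith : 0 < α - 1) (by norm_num : (1 / 2 : ℝ) < 1)
  have hαn : (1 : ℝ) + (1 / 2 : ℝ) ^ n ≤ α := by linarith
  obtain ⟨K, hK0, hK⟩ := hseq n
  set V₁ : ℝ := volume.real (closedBall (0 : EuclideanSpace ℝ (Fin 3)) 1) with hV₁
  have hV₁0 : 0 ≤ V₁ := measureReal_nonneg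
  refine ⟨K + C ^ 2 * V₁, by positivity, fun t ht R hR => ?_⟩
  have hX : 0 ≤ R ^ α * (-t) ^ (-((α - 1) / 2)) :=
    mul_nonneg (Real.rpow_nonneg hR.le _) (Real.rpow_nonneg (by linarith) _)
  rcases le_or_gt (Real.sqrt (-t)) R with hle | hlt
  · calc _ ≤ K * R ^ ((1 : ℝ) + (1 / 2 : ℝ) ^ n) *
          (-t) ^ (-(((1 : ℝ) + (1 / 2 : ℝ) ^ n - 1) / 2)) := hK t ht R hR
      _ ≤ K * R ^ α * (-t) ^ (-((α - 1) / 2)) := level_mono hK0 hαn ht hle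
      _ ≤ (K + C ^ 2 * V₁) * R ^ α * (-t) ^ (-((α - 1) / 2)) := by
          rw [mul_assoc, mul_assoc]; exact mul_le_mul_of_nonneg_right (by nlinarith) hX
  · have h := setIntegral_closedBall_norm_sq_le_of_small hrate hα3 ht hR hlt.le
    calc _ ≤ C ^ 2 * V₁ * R ^ α * (-t) ^ (-((α - 1) / 2)) := h
      _ ≤ (K + C ^ 2 * V₁) * R ^ α * (-t) ^ (-((α - 1) / 2)) := by
          rw [mul_assoc (K + _), mul_assoc (C ^ 2 * V₁)]; exact mul_le_mul_of_nonneg_right (by linarith) hX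

end Summit.NavierStokesRegularity.NavierStokesRegularity.Theorems.PoloidalWindowDoorPoloidalWindowRigidityLargeScaleEnergyBootstrapFloor

end
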